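import Summits.QuantumFields.YangMills.Theorems.BalabanUVNodesK0AxGaugeFlowRecDefs
import Summits.QuantumFields.YangMills.Theorems.BalabanUVNodesPortS1Sect4WardRows
import Summits.QuantumFields.YangMills.Theorems.BalabanUVNodesK0PortChart44DAtRecord

/-!
# NODE-O cover ∕ ◇ LENS-1 («cauchy-analytic») g7 — `LENS-1-GaugeFlowRec-v1.lean`: LEAF (B) OF NODE v8 AT THE RECORD —
# the (4.8) gauge flow `exp(tλ)` of the record's NAMED action `recordAct`, charted by the record's NAMED two-block chart `recordChartJ`
# on the record's NAMED coordinates `recordCoords`, with origin-velocity the lattice gradient `recordGradLeg λ` (ALL site functions `λ`)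

LANDING NOTE (porter `ymgap-nodeO-port-PTB-1` g4, 2026-08-31): ◇ lens-1 g7's `nodeO-cover/LENS-1-GaugeFlowRec-v1.lean` (600f5219c8e2c257) LANDED under ◆ CRIT-1 g35's
custody cut 06:17:16Z (PASS ×3: by name ∕ no junk ∕ located ·S condition discharged in kernel) and hosting word: §0 dropped (= ✓ `Literature/…/B12ChartGaugeFlow48`, p812753,
imported), the 8 definitions (+ their defining lemmas) are `…/Theorems/BalabanUVNodesK0AxGaugeFlowRecDefs.lean`, the theorems are THIS file; decl names and statements
UNCHANGED (docstrings ∕ cite tags added where the HOME file had none; the three bookkeeping lemmas `sl2Coord_chartMatU'`, `sl2Coord_chartMatJc'`,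
`trace_chartMatJc'` of the HOME file are DROPPED for the tree's ✓`BalabanUVNodesPortS1.sl2Coord_chartMatU∕Jc`, ✓`K0PortChart44DAtRecord.trace_chartMatJc` — gate `dedup.landed`); namespace `Summit.QuantumFields.YangMills.Theorems.K0AxGaugeFlowRec`.
`--supports stmt-QuantumFields-27238 --as helper`.  With ✓`…K0AxTransverseWardRoad` (NODE v8 (A)) this closes leaf (B); (δ)'s remaining content = leaf (C)♯ (MODULO P0) + the
(D1) face.

HONEST FRAMING.  Record-level calculus ∕ matrix bookkeeping (series logarithm near `1`, `det = 1 ⟹ tr log = 0`, `D log(1) = id`, chain rules); nothing of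
Bałaban is asserted, ported or discharged; typed ≠ proved for anything not in this file; K0ᴬ `Record13SepCoPHInhabitedAx` (stmt-QuantumFields-27238) OPEN;
NODE O 0∕1; COUNT 8∕28 · K 1∕4 UNMOVED; ONE finite `𝕋⁴_{L^K}` at fixed ε — NOT continuum ∕ OS ∕ Clay; **the Yang–Mills mass gap is NOT proved by any of this.**
Author: planner seat `ymgap-nodeO-lens-1` g7 (2026-08-31).  No `sorry`, no `instance`, no `notation`.
-/

noncomputable section

open scoped BigOperators Matrix.Norms.L2Operator Topology
open Set Filter Metric
open NormedSpace (exp)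

namespace Summit.QuantumFields.YangMills.Theorems.K0AxGaugeFlowRec

open Summit.QuantumFields.YangMills.Theorems.K0RecordFormatNames
open Summit.QuantumFields.YangMills.Theorems
open Literature.MathematicalPhysics.QuantumFieldTheory.Balaban1983to89
open Literature.MathematicalPhysics.QuantumFieldTheory.Balaban1983to89.Node00
open Literature.MathematicalPhysics.QuantumFieldTheory.Balaban1983to89.T4Continuum (T4Family)
open Literature.MathematicalPhysics.QuantumFieldTheory.Balaban1983to89.Beta.BackgroundVertices (expUnit val_expUnit val_inv_expUnit)

open Literature.MathematicalPhysics.QuantumFieldTheory.Balaban1983to89.B12ChartGaugeFlow48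

variable (F : T4Family)

/-! ## §2  Algebra of the flow map: what the chart reads back -/

/-- The `𝐔`-block chart matrix is traceless. [cite: Balaban1987RG1, (1.9) p.261 (bookkeeping)] -/
theorem trace_chartMatU (K : ℕ) (w : Fin (recordChartDimJ F K) → ℂ) (b : PBond (F.P K) 0) : (chartMatU F K w b).trace = 0 := by
  simp [chartMatU, sl2Gen, Matrix.trace_fin_two, Fin.sum_univ_three]




/-- `det exp(W_U(b)) = 1` (traceless exponent). [cite: Balaban1987RG1, (1.10) p.262 (bookkeeping)] -/
theorem det_exp_chartMatU (K : ℕ) (w : Fin (recordChartDimJ F K) → ℂ) (b : PBond (F.P K) 0) : (exp (chartMatU F K w b)).det = 1 := by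
  rw [Literature.Analysis.Matrix.det_exp_eq_exp_trace, trace_chartMatU, NormedSpace.exp_zero]

/-- The `𝐔`-block chart matrix of the origin is `0`. [cite: Balaban1987RG1, (1.9) p.261 (bookkeeping)] -/
@[simp] theorem chartMatU_zero (K : ℕ) (b : PBond (F.P K) 0) : chartMatU F K 0 b = 0 := by simp [chartMatU]

/-- The `𝐉`-block chart matrix of the origin is `0`. [cite: Balaban1987RG1, (1.9) p.261 (bookkeeping)] -/
@[simp] theorem chartMatJc_zero (K : ℕ) (b : PBond (F.P K) 0) : chartMatJc F K 0 b = 0 := by simp [chartMatJc]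

/-- `chartMatU` of read-back coordinates = the traceless part of `log 𝐔(b)`. [cite: Balaban1987RG1, (1.9) p.261 (bookkeeping)] -/
theorem chartMatU_pairCoordsJ (K : ℕ) (φ : Sect2.CPair (F.P K) (MatA 2)) (b : PBond (F.P K) 0) :
    chartMatU F K (pairCoordsJ F K φ) b = MatrixLog.mlog (φ.1 b) - ((MatrixLog.mlog (φ.1 b)).trace / 2) • (1 : MatA 2) := by
  have h : chartMatU F K (pairCoordsJ F K φ) b = ∑ a : Fin 3, sl2Coord (MatrixLog.mlog (φ.1 b)) a • sl2Gen a := by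
    simp [chartMatU, pairCoordsJ]
  rw [h, BalabanUVNodesPortS1.sum_sl2Coord_smul_sl2Gen]

/-- `chartMatJc` of read-back coordinates = the traceless part of `𝐉(b)`. [cite: Balaban1987RG1, (1.9) p.261 (bookkeeping)] -/
theorem chartMatJc_pairCoordsJ (K : ℕ) (φ : Sect2.CPair (F.P K) (MatA 2)) (b : PBond (F.P K) 0) :
    chartMatJc F K (pairCoordsJ F K φ) b = φ.2 b - ((φ.2 b).trace / 2) • (1 : MatA 2) := by
  have h : chartMatJc F K (pairCoordsJ F K φ) b = ∑ a : Fin 3, sl2Coord (φ.2 b) a • sl2Gen a := by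
    simp [chartMatJc, pairCoordsJ]
  rw [h, BalabanUVNodesPortS1.sum_sl2Coord_smul_sl2Gen]


/-- The gauge-transformed `𝐔`-block has determinant `1`. [cite: Balaban1987RG1, (1.10) p.262 (bookkeeping)] -/
theorem det_actU (K : ℕ) (u : recordGaugeGrp F K) (w : Fin (recordChartDimJ F K) → ℂ) (b : PBond (F.P K) 0) : (actU F K u w b).det = 1 := by
  have h1 : ((u.1 b.src : (MatA 2)ˣ) : MatA 2).det = 1 := B12RegularSpaces111SpecialUnitary.mem_suModel_Gc.1 (u.2 b.src)
  have h2 : ((u.1 b.tgt : (MatA 2)ˣ) : MatA 2).det = 1 := B12RegularSpaces111SpecialUnitary.mem_suModel_Gc.1 (u.2 b.tgt)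
  have h3 : (((u.1 b.tgt)⁻¹ : (MatA 2)ˣ) : MatA 2).det = 1 := by
    have h := congrArg Matrix.det (Units.mul_inv (u.1 b.tgt))
    rw [Matrix.det_mul, h2, one_mul, Matrix.det_one] at h
    exact h
  rw [actU, Matrix.det_mul, Matrix.det_mul, h1, det_exp_chartMatU, h3, mul_one, mul_one]

/-- ★ **ROUND TRIP, `𝐔`-BLOCK**: where the transformed `𝐔`-block is within `½` of the unit, the chart reads the flow map back EXACTLY:
`exp (chartMatU (φ_u w) b) = u₋ e^{W_U(b)} u₊⁻¹` (`det = 1 ⟹ tr log = 0`, `exp log = id`). [cite: Balaban1987RG1, (4.8) p.283, (1.9)–(1.10) pp.261–262] -/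
theorem exp_chartMatU_gaugeFlowMap (K : ℕ) (u : recordGaugeGrp F K) (w : Fin (recordChartDimJ F K) → ℂ) (b : PBond (F.P K) 0)
    (h : ‖actU F K u w b - 1‖ ≤ 1 / 2) :
    exp (chartMatU F K (gaugeFlowMap F K u w) b) = actU F K u w b := by
  have hφ : (Sect2.cAct u.1 (chartPairJ F K w)).1 b = actU F K u w b := rfl
  rw [gaugeFlowMap, chartMatU_pairCoordsJ, hφ, PortHRecordJoin.trace_mlog_eq_zero_of_det_eq_one _ h (det_actU F K u w b), zero_div, zero_smul,
    sub_zero]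
  exact MatrixLog.exp_mlog (by linarith)

/-- ★ **ROUND TRIP, `𝐉`-BLOCK** (always): `chartMatJc (φ_u w) b = u₋ W_J(b) u₋⁻¹` (`tr (u J u⁻¹) = tr J = 0`). [cite: Balaban1987RG1, (1.10) p.262] -/
theorem chartMatJc_gaugeFlowMap (K : ℕ) (u : recordGaugeGrp F K) (w : Fin (recordChartDimJ F K) → ℂ) (b : PBond (F.P K) 0) :
    chartMatJc F K (gaugeFlowMap F K u w) b = (u.1 b.src : MatA 2) * chartMatJc F K w b * ((u.1 b.src)⁻¹ : (MatA 2)ˣ) := by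
  have hφ : (Sect2.cAct u.1 (chartPairJ F K w)).2 b = (u.1 b.src : MatA 2) * chartMatJc F K w b * ((u.1 b.src)⁻¹ : (MatA 2)ˣ) := rfl
  have htr : ((u.1 b.src : MatA 2) * chartMatJc F K w b * ((u.1 b.src)⁻¹ : (MatA 2)ˣ)).trace = 0 := by
    rw [Matrix.trace_mul_cycle, Units.inv_mul, one_mul, K0PortChart44DAtRecord.trace_chartMatJc]
  rw [gaugeFlowMap, chartMatJc_pairCoordsJ, hφ, htr, zero_div, zero_smul, sub_zero]

/-! ## §3  CLAUSE 3: the flow map of the trivial transformation fixes the origin -/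

/-- At `t = 0` the flow is the trivial transformation. [cite: Balaban1987RG1, (4.8) p.283 (bookkeeping)] -/
theorem expGauge_zero_apply (K : ℕ) (lam : Site (F.P K) 0 → Fin 3 → ℂ) (x : Site (F.P K) 0) :
    ((expGauge F K lam 0).1 x : MatA 2) = 1 ∧ ((((expGauge F K lam 0).1 x)⁻¹ : (MatA 2)ˣ) : MatA 2) = 1 := by
  simp

/-- ★ CLAUSE 3: `φ_{exp(0·Λ)}(0) = 0`. [cite: Balaban1987RG1, (4.8) p.283] -/
theorem gaugeFlowMap_expGauge_zero (K : ℕ) (lam : Site (F.P K) 0 → Fin 3 → ℂ) : gaugeFlowMap F K (expGauge F K lam 0) 0 = 0 := by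
  funext i
  simp only [gaugeFlowMap, pairCoordsJ, chartPairJ, Sect2.cAct, Pi.zero_apply]
  rcases ((chartEquivJ F K).symm i).2 with a | a
  · simp [MatrixLog.mlog_one, PortU8.sl2Coord_zero]
  · simp [PortU8.sl2Coord_zero]

/-! ## §4  CLAUSE 4: the orbit of the origin has velocity the gradient leg -/

/-- `d∕dt|₀ exp(tΛ₋)·exp(−tΛ₊) = Λ₋ − Λ₊` (real parameter; `NormedAlgebra ℝ (M₂(ℂ))` by restriction of scalars). [folklore] -/
theorem hasDerivAt_exp_mul_exp_neg (P Q : MatA 2) :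
    HasDerivAt (fun t : ℝ => exp ((t : ℂ) • P) * 1 * exp (-((t : ℂ) • Q))) (P - Q) 0 := by
  have hP : HasDerivAt (fun t : ℝ => exp (t • P)) P 0 :=
    (hasDerivAt_exp_smul_const' (𝕂 := ℝ) P (0 : ℝ)).congr_deriv (by rw [zero_smul, NormedSpace.exp_zero, mul_one])
  have hQ : HasDerivAt (fun t : ℝ => exp (t • (-Q))) (-Q) 0 :=
    (hasDerivAt_exp_smul_const' (𝕂 := ℝ) (-Q) (0 : ℝ)).congr_deriv (by rw [zero_smul, NormedSpace.exp_zero, mul_one])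
  have h : HasDerivAt (fun t : ℝ => exp (t • P) * exp (t • (-Q))) (P * exp ((0 : ℝ) • (-Q)) + exp ((0 : ℝ) • P) * (-Q)) 0 := hP.mul hQ
  rw [zero_smul, zero_smul, NormedSpace.exp_zero] at h
  rw [mul_one, one_mul, ← sub_eq_add_neg] at h
  refine h.congr_of_eventuallyEq (Eventually.of_forall fun t => ?_)
  show exp ((t : ℂ) • P) * 1 * exp (-((t : ℂ) • Q)) = exp (t • P) * exp (t • (-Q))
  rw [mul_one, smul_neg, Complex.coe_smul, Complex.coe_smul]

/-- ★★ CLAUSE 4: `d∕dt|₀ φ_{exp(tΛ_λ)}(0) = recordGradLeg λ` (`D log(1) = id`, `sl2Coord (Λ(b₋) − Λ(b₊)) = λ(b₋) − λ(b₊)`; the `𝐉`-block of the origin is `0` along the flow).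
[cite: Balaban1987RG1, (4.8) p.283 («− g⁻¹(iad_B)∂λ» at B = 0), (4.15) p.284] -/
theorem hasDerivAt_gaugeFlowMap_expGauge (K : ℕ) (lam : Site (F.P K) 0 → Fin 3 → ℂ) :
    HasDerivAt (fun t : ℝ => gaugeFlowMap F K (expGauge F K lam t) 0) (recordGradLeg F K lam) 0 := by
  rw [hasDerivAt_pi]
  intro i
  simp only [gaugeFlowMap, pairCoordsJ, chartPairJ, Sect2.cAct, recordGradLeg]
  rcases ((chartEquivJ F K).symm i).2 with a | a
  · simp only [Sum.elim_inl, chartMatU_zero, NormedSpace.exp_zero, coe_expGauge, coe_inv_expGauge]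
    set b := ((chartEquivJ F K).symm i).1
    obtain ⟨L, hL, hLd⟩ := PortU8.hasFDerivAt_sl2Coord a (1 : MatA 2)
    have hg := hasDerivAt_exp_mul_exp_neg (gaugeGen F K lam b.src) (gaugeGen F K lam b.tgt)
    have hm : HasFDerivAt (MatrixLog.mlog : MatA 2 → MatA 2) (ContinuousLinearMap.id ℝ (MatA 2))
        ((fun t : ℝ => exp ((t : ℂ) • gaugeGen F K lam b.src) * 1 * exp (-((t : ℂ) • gaugeGen F K lam b.tgt))) 0) := by
      simp only [Complex.ofReal_zero, zero_smul, neg_zero, NormedSpace.exp_zero, mul_one]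
      exact PortU8.hasFDerivAt_mlog_one_real
    have hmg := hm.comp_hasDerivAt (0 : ℝ) hg
    have hLd' : HasFDerivAt (fun A : MatA 2 => sl2Coord A a) L
        ((MatrixLog.mlog ∘ fun t : ℝ => exp ((t : ℂ) • gaugeGen F K lam b.src) * 1 * exp (-((t : ℂ) • gaugeGen F K lam b.tgt))) 0) := by
      simp only [Function.comp_apply, Complex.ofReal_zero, zero_smul, neg_zero, NormedSpace.exp_zero, mul_one, MatrixLog.mlog_one]
      obtain ⟨L', hL', hLd'⟩ := PortU8.hasFDerivAt_sl2Coord a (0 : MatA 2)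
      have : L' = L := by ext A; rw [hL', hL]
      rw [← this]; exact hLd'
    have h := hLd'.comp_hasDerivAt (0 : ℝ) hmg
    simp only [ContinuousLinearMap.id_apply, hL, sl2Coord_sub, Pi.sub_apply, sl2Coord_gaugeGen] at h
    exact h
  · simp only [Sum.elim_inr, chartMatJc_zero, mul_zero, zero_mul, PortU8.sl2Coord_zero, Pi.zero_apply]
    exact hasDerivAt_const (0 : ℝ) (0 : ℂ)

/-! ## §5  CLAUSE 1 (pointwise): the chart intertwines the flow map with `recordAct` ON THE COORDINATES OF `X` -/

open scoped Classical in
/-- ★★ **INTERTWINING ON `recordCoords X`** (located ·S: `recordCoords X` and the uncut bonds of `recordChartJ X` are filtered by the SAME `domBonds X`): where the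
transformed `𝐔`-blocks are within `½` of the unit, `χ_X(φ_u(w)) = (χ_X(w))^u` on every coordinate the piece `𝐄(X)` reads. [cite: Balaban1987RG1, (4.8) p.283, (1.7) p.261, (1.10) p.262] -/
theorem recordChartJ_gaugeFlowMap (Mc k K : ℕ) (X : (recordDomSys F Mc k K).Dom) (u : recordGaugeGrp F K) (w : Fin (recordChartDimJ F K) → ℂ)
    (hW : ∀ b ∈ domBonds F Mc k K X, ‖actU F K u w b - 1‖ ≤ 1 / 2) :
    ∀ i ∈ recordCoords F Mc k K X, recordChartJ F Mc k K X (gaugeFlowMap F K u w) i = recordAct F K u (recordChartJ F Mc k K X w) i := by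
  classical
  intro i hi
  rw [recordAct, recordChartJ, recordChartJ, decodeCfg_encodeCfg]
  obtain ⟨c, rfl⟩ : ∃ c, cfgEquiv F K c = i := ⟨(cfgEquiv F K).symm i, Equiv.apply_symm_apply _ _⟩
  have hc : Sum.elim id id c.1 ∈ domBonds F Mc k K X := by
    simpa [recordCoords] using hi
  rcases c with ⟨b | b, e₁, e₂⟩
  · have hb : b ∈ domBonds F Mc k K X := by simpa using hc
    simp only [encodeCfg, Equiv.symm_apply_apply, Sum.elim_inl, Sect2.cAct, if_pos hb]
    rw [exp_chartMatU_gaugeFlowMap F K u w b (hW b hb)]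
    rfl
  · have hb : b ∈ domBonds F Mc k K X := by simpa using hc
    simp only [encodeCfg, Equiv.symm_apply_apply, Sum.elim_inr, Sect2.cAct, if_pos hb]
    rw [chartMatJc_gaugeFlowMap F K u w b]

/-! ## §6  Smallness along the flow: EVENTUALLY in `t`, then EVENTUALLY in the chart input -/

/-- `exp` is continuous on `M₂(ℂ)` (from analyticity; avoids the `ℚ`-algebra phrasing of `NormedSpace.exp_continuous`). [folklore] -/
theorem continuous_mexp : Continuous (exp : MatA 2 → MatA 2) :=
  continuous_iff_continuousAt.2 fun x => (NormedSpace.exp_analytic (𝕂 := ℂ) x).continuousAt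

/-- `t ↦ exp(t·P)` is continuous. [folklore] -/
theorem continuous_exp_ofReal_smul (P : MatA 2) : Continuous fun t : ℝ => exp ((t : ℂ) • P) :=
  continuous_mexp.comp (Complex.continuous_ofReal.smul continuous_const)

/-- The gauge-transformed `𝐔`-block depends continuously on the chart input. [folklore] -/
theorem continuous_actU (K : ℕ) (u : recordGaugeGrp F K) (b : PBond (F.P K) 0) : Continuous fun w : Fin (recordChartDimJ F K) → ℂ => actU F K u w b := by
  have h : Continuous fun w : Fin (recordChartDimJ F K) → ℂ => chartMatU F K w b := (chartMatULM F K b).continuous_of_finiteDimensional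
  exact (continuous_const.mul (continuous_mexp.comp h)).mul continuous_const

/-- For `t` near `0` every flowed origin `exp(tΛ(b₋))·exp(−tΛ(b₊))` is within `¼` of the unit (finitely many bonds). [cite: Balaban1987RG1, (4.8) p.283 (bookkeeping)] -/
theorem eventually_actU_expGauge_zero (K : ℕ) (lam : Site (F.P K) 0 → Fin 3 → ℂ) :
    ∀ᶠ t in 𝓝 (0 : ℝ), ∀ b : PBond (F.P K) 0, ‖actU F K (expGauge F K lam t) 0 b - 1‖ < 1 / 4 := by
  refine eventually_all.2 fun b => ?_
  have hc : Continuous fun t : ℝ => actU F K (expGauge F K lam t) 0 b := by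
    simp only [actU, coe_expGauge, coe_inv_expGauge, chartMatU_zero, NormedSpace.exp_zero, mul_one]
    refine (continuous_exp_ofReal_smul _).mul ?_
    have : (fun t : ℝ => exp (-((t : ℂ) • gaugeGen F K lam b.tgt))) = fun t : ℝ => exp ((t : ℂ) • (-gaugeGen F K lam b.tgt)) := by
      funext t; rw [smul_neg]
    rw [this]; exact continuous_exp_ofReal_smul _
  have h0 : actU F K (expGauge F K lam 0) 0 b = 1 := by simp [actU]
  have hc' : Continuous fun t : ℝ => ‖actU F K (expGauge F K lam t) 0 b - 1‖ := (hc.sub continuous_const).norm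
  have ht : Tendsto (fun t : ℝ => ‖actU F K (expGauge F K lam t) 0 b - 1‖) (𝓝 0) (𝓝 0) := by
    have := hc'.tendsto (0 : ℝ)
    rwa [h0, sub_self, norm_zero] at this
  exact ht.eventually_lt_const (by norm_num)

/-- For a transformation whose origin images are within `¼` of the unit, chart inputs near `0` keep the transformed `𝐔`-blocks within `½` and `W_U` inside the
`log`-window. [cite: Balaban1987RG1, (4.8) p.283 (bookkeeping)] -/
theorem eventually_actU_small (K : ℕ) (u : recordGaugeGrp F K) (hu : ∀ b : PBond (F.P K) 0, ‖actU F K u 0 b - 1‖ < 1 / 4) :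
    ∀ᶠ w in 𝓝 (0 : Fin (recordChartDimJ F K) → ℂ), ∀ b : PBond (F.P K) 0, ‖actU F K u w b - 1‖ < 1 / 2 ∧ ‖chartMatU F K w b‖ < Real.log 2 := by
  refine eventually_all.2 fun b => ?_
  have hc' : Continuous fun w : Fin (recordChartDimJ F K) → ℂ => ‖actU F K u w b - 1‖ := ((continuous_actU F K u b).sub continuous_const).norm
  have h1 : Tendsto (fun w : Fin (recordChartDimJ F K) → ℂ => ‖actU F K u w b - 1‖) (𝓝 0) (𝓝 ‖actU F K u 0 b - 1‖) := hc'.tendsto 0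
  have h2 : Tendsto (fun w : Fin (recordChartDimJ F K) → ℂ => ‖chartMatU F K w b‖) (𝓝 0) (𝓝 0) := by
    have := ((chartMatULM F K b).continuous_of_finiteDimensional.norm).tendsto (0 : Fin (recordChartDimJ F K) → ℂ)
    simpa using this
  have hlog : (0 : ℝ) < Real.log 2 := Real.log_pos (by norm_num)
  exact (h1.eventually_lt_const (by linarith [hu b])).and (h2.eventually_lt_const hlog)

/-- ★★ CLAUSE 1 (eventual form of `ChartGaugeFlow`): for `t` near `0`, for every domain `X`, for chart inputs near `0`, on `recordCoords X`.
[cite: Balaban1987RG1, (4.8) p.283, (1.7) p.261] -/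
theorem eventually_recordChartJ_gaugeFlowMap (Mc k K : ℕ) (lam : Site (F.P K) 0 → Fin 3 → ℂ) :
    ∀ᶠ t in 𝓝 (0 : ℝ), ∀ X : (recordDomSys F Mc k K).Dom, ∀ᶠ w in 𝓝 (0 : Fin (recordChartDimJ F K) → ℂ),
      ∀ i ∈ recordCoords F Mc k K X,
        recordChartJ F Mc k K X (gaugeFlowMap F K (expGauge F K lam t) w) i = recordAct F K (expGauge F K lam t) (recordChartJ F Mc k K X w) i := by
  filter_upwards [eventually_actU_expGauge_zero F K lam] with t ht X
  filter_upwards [eventually_actU_small F K _ ht] with w hw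
  exact recordChartJ_gaugeFlowMap F Mc k K X _ w fun b _ => (hw b).1.le

/-! ## §7  CLAUSE 2: the flow map is analytic at the origin with an invertible derivative (left inverse = the flow map of `u⁻¹`) -/

/-- Each 𝔰𝔩₂-coordinate is a continuous ℂ-linear functional on `M₂(ℂ)`. [folklore] -/
theorem exists_sl2CoordCLM (a : Fin 3) : ∃ L : MatA 2 →L[ℂ] ℂ, ∀ A, L A = sl2Coord A a :=
  ⟨LinearMap.toContinuousLinearMap
    { toFun := fun A => sl2Coord A a
      map_add' := fun A B => by rw [sl2Coord_add]; rfl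
      map_smul' := fun c A => by rw [sl2Coord_smul]; rfl }, fun _ => rfl⟩

/-- The transformed `𝐔`-block is analytic in the chart input. [cite: Balaban1987RG1, (4.8) p.283 (bookkeeping)] -/
theorem analyticAt_actU (K : ℕ) (u : recordGaugeGrp F K) (b : PBond (F.P K) 0) (w₀ : Fin (recordChartDimJ F K) → ℂ) :
    AnalyticAt ℂ (fun w => actU F K u w b) w₀ := by
  have h1 : AnalyticAt ℂ (fun w : Fin (recordChartDimJ F K) → ℂ => chartMatU F K w b) w₀ :=
    (LinearMap.toContinuousLinearMap (chartMatULM F K b)).analyticAt w₀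
  have h2 : AnalyticAt ℂ (fun w : Fin (recordChartDimJ F K) → ℂ => exp (chartMatU F K w b)) w₀ :=
    AnalyticAt.comp (f := fun w => chartMatU F K w b) (x := w₀) (NormedSpace.exp_analytic (𝕂 := ℂ) _) h1
  exact (analyticAt_const.mul h2).mul analyticAt_const

/-- ★ **The flow map is ANALYTIC** wherever the transformed `𝐔`-blocks are inside the `log`-ball. [cite: Balaban1987RG1, (4.8) p.283 (analyticity of the flow in the chart)] -/
theorem analyticAt_gaugeFlowMap (K : ℕ) (u : recordGaugeGrp F K) (w₀ : Fin (recordChartDimJ F K) → ℂ) (h : ∀ b : PBond (F.P K) 0, ‖actU F K u w₀ b - 1‖ < 1) :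
    AnalyticAt ℂ (gaugeFlowMap F K u) w₀ := by
  have hcoord : ∀ i, AnalyticAt ℂ (fun w => gaugeFlowMap F K u w i) w₀ := by
    intro i
    rcases hc : ((chartEquivJ F K).symm i).2 with a | a
    · obtain ⟨L, hL⟩ := exists_sl2CoordCLM a
      have hlog : AnalyticAt ℂ (MatrixLog.mlog : MatA 2 → MatA 2) (actU F K u w₀ ((chartEquivJ F K).symm i).1) := MatrixLog.analyticAt_mlog (h _)
      have hin : AnalyticAt ℂ (fun w => MatrixLog.mlog (actU F K u w ((chartEquivJ F K).symm i).1)) w₀ :=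
        AnalyticAt.comp (g := MatrixLog.mlog) (f := fun w => actU F K u w ((chartEquivJ F K).symm i).1) (x := w₀) hlog
          (analyticAt_actU F K u ((chartEquivJ F K).symm i).1 w₀)
      have hcomp : AnalyticAt ℂ (fun w => L (MatrixLog.mlog (actU F K u w ((chartEquivJ F K).symm i).1))) w₀ :=
        AnalyticAt.comp (g := fun A => L A) (f := fun w => MatrixLog.mlog (actU F K u w ((chartEquivJ F K).symm i).1)) (x := w₀) (L.analyticAt _) hin
      refine hcomp.congr (Eventually.of_forall fun w => ?_)
      simp only [hL, gaugeFlowMap, pairCoordsJ, hc, Sum.elim_inl]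
      rfl
    · obtain ⟨L, hL⟩ := exists_sl2CoordCLM a
      have hJ : AnalyticAt ℂ (fun w : Fin (recordChartDimJ F K) → ℂ =>
          (u.1 ((chartEquivJ F K).symm i).1.src : MatA 2) * chartMatJc F K w ((chartEquivJ F K).symm i).1 *
            ((u.1 ((chartEquivJ F K).symm i).1.src)⁻¹ : (MatA 2)ˣ)) w₀ :=
        (analyticAt_const.mul ((LinearMap.toContinuousLinearMap (chartMatJcLM F K ((chartEquivJ F K).symm i).1)).analyticAt w₀)).mul
          analyticAt_const
      have hcomp : AnalyticAt ℂ (fun w : Fin (recordChartDimJ F K) → ℂ => L ((u.1 ((chartEquivJ F K).symm i).1.src : MatA 2) *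
          chartMatJc F K w ((chartEquivJ F K).symm i).1 * ((u.1 ((chartEquivJ F K).symm i).1.src)⁻¹ : (MatA 2)ˣ))) w₀ :=
        AnalyticAt.comp (g := fun A => L A) (x := w₀) (L.analyticAt _) hJ
      refine hcomp.congr (Eventually.of_forall fun w => ?_)
      simp only [hL, gaugeFlowMap, pairCoordsJ, hc, Sum.elim_inr]
      rfl
  exact AnalyticAt.pi (f := fun i w => gaugeFlowMap F K u w i) hcoord



/-- Conjugation round trip in the unit group: `v₁⁻¹(v₁ E v₂⁻¹)v₂ = E`. [folklore] -/
theorem units_conj_roundtrip (v₁ v₂ : (MatA 2)ˣ) (E : MatA 2) :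
    ((v₁⁻¹ : (MatA 2)ˣ) : MatA 2) * ((v₁ : MatA 2) * E * ((v₂⁻¹ : (MatA 2)ˣ) : MatA 2)) * (((v₂⁻¹)⁻¹ : (MatA 2)ˣ) : MatA 2) = E := by
  rw [inv_inv, ← mul_assoc, ← mul_assoc, Units.inv_mul, one_mul, Units.inv_mul_cancel_right]

/-- ★ **LEFT INVERSE**: `φ_{u⁻¹}(φ_u(w)) = w` where the transformed `𝐔`-blocks are within `½` of the unit and `W_U` is inside the `log`-window
(`log(u₋⁻¹·(u₋ e^{A} u₊⁻¹)·u₊) = log e^{A} = A`). [cite: Balaban1987RG1, (4.8) p.283, (1.10) p.262; Balaban1985Averaging, (21) p.21] -/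
theorem gaugeFlowMap_invGauge_gaugeFlowMap (K : ℕ) (u : recordGaugeGrp F K) (w : Fin (recordChartDimJ F K) → ℂ)
    (hW : ∀ b : PBond (F.P K) 0, ‖actU F K u w b - 1‖ ≤ 1 / 2) (hA : ∀ b : PBond (F.P K) 0, ‖chartMatU F K w b‖ < Real.log 2) :
    gaugeFlowMap F K (invGauge F K u) (gaugeFlowMap F K u w) = w := by
  funext i
  have hp : ∀ s : Fin 3 ⊕ Fin 3, (chartEquivJ F K).symm i = (((chartEquivJ F K).symm i).1, s) → i = chartEquivJ F K (((chartEquivJ F K).symm i).1, s) :=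
    fun s hs => by rw [← hs, Equiv.apply_symm_apply]
  rcases hc : ((chartEquivJ F K).symm i).2 with a | a
  · have hU : actU F K (invGauge F K u) (gaugeFlowMap F K u w) ((chartEquivJ F K).symm i).1 = exp (chartMatU F K w ((chartEquivJ F K).symm i).1) := by
      rw [actU, exp_chartMatU_gaugeFlowMap F K u w _ (hW _), actU]
      exact units_conj_roundtrip _ _ _
    have : gaugeFlowMap F K (invGauge F K u) (gaugeFlowMap F K u w) i =
        sl2Coord (MatrixLog.mlog (actU F K (invGauge F K u) (gaugeFlowMap F K u w) ((chartEquivJ F K).symm i).1)) a := by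
      simp only [gaugeFlowMap, pairCoordsJ, hc, Sum.elim_inl]; rfl
    rw [this, hU, B7BlockAvgLog.mlog_exp (hA _), BalabanUVNodesPortS1.sl2Coord_chartMatU]
    exact congrArg w (hp (Sum.inl a) (Prod.ext rfl hc)).symm
  · have hJ : ((invGauge F K u).1 ((chartEquivJ F K).symm i).1.src : MatA 2) * chartMatJc F K (gaugeFlowMap F K u w) ((chartEquivJ F K).symm i).1 *
        (((invGauge F K u).1 ((chartEquivJ F K).symm i).1.src)⁻¹ : (MatA 2)ˣ) = chartMatJc F K w ((chartEquivJ F K).symm i).1 := by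
      rw [chartMatJc_gaugeFlowMap]
      exact units_conj_roundtrip _ _ _
    have : gaugeFlowMap F K (invGauge F K u) (gaugeFlowMap F K u w) i =
        sl2Coord (((invGauge F K u).1 ((chartEquivJ F K).symm i).1.src : MatA 2) * chartMatJc F K (gaugeFlowMap F K u w) ((chartEquivJ F K).symm i).1 *
          (((invGauge F K u).1 ((chartEquivJ F K).symm i).1.src)⁻¹ : (MatA 2)ˣ)) a := by
      simp only [gaugeFlowMap, pairCoordsJ, hc, Sum.elim_inr]; rfl
    rw [this, hJ, BalabanUVNodesPortS1.sl2Coord_chartMatJc]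
    exact congrArg w (hp (Sum.inr a) (Prod.ext rfl hc)).symm

/-- ★★ CLAUSE 2: for a transformation whose origin images are within `¼` of the unit, the flow map is (complex-)differentiable at `0` with a SURJECTIVE derivative
(left inverse differentiable at the image ⟹ injective derivative ⟹ surjective, finite dimension). [cite: Balaban1987RG1, (4.8) p.283] -/
theorem hasFDerivAt_gaugeFlowMap_surjective (K : ℕ) (u : recordGaugeGrp F K) (hu : ∀ b : PBond (F.P K) 0, ‖actU F K u 0 b - 1‖ < 1 / 4) :
    HasFDerivAt (gaugeFlowMap F K u) (fderiv ℂ (gaugeFlowMap F K u) 0) 0 ∧ Function.Surjective (fderiv ℂ (gaugeFlowMap F K u) 0) := by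
  have hφ : AnalyticAt ℂ (gaugeFlowMap F K u) 0 := analyticAt_gaugeFlowMap F K u 0 fun b => by linarith [hu b]
  have hd : HasFDerivAt (gaugeFlowMap F K u) (fderiv ℂ (gaugeFlowMap F K u) 0) 0 := hφ.differentiableAt.hasFDerivAt
  refine ⟨hd, ?_⟩
  have h1 : ∀ b : PBond (F.P K) 0, actU F K (invGauge F K u) (gaugeFlowMap F K u 0) b = 1 := fun b => by
    rw [actU, exp_chartMatU_gaugeFlowMap F K u 0 b (by linarith [hu b]), actU, chartMatU_zero, NormedSpace.exp_zero]
    exact units_conj_roundtrip _ _ _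
  have hψ : AnalyticAt ℂ (gaugeFlowMap F K (invGauge F K u)) (gaugeFlowMap F K u 0) :=
    analyticAt_gaugeFlowMap F K _ _ fun b => by rw [h1 b, sub_self, norm_zero]; exact one_pos
  set L := fderiv ℂ (gaugeFlowMap F K u) 0
  set L' := fderiv ℂ (gaugeFlowMap F K (invGauge F K u)) (gaugeFlowMap F K u 0)
  have hcomp : HasFDerivAt (gaugeFlowMap F K (invGauge F K u) ∘ gaugeFlowMap F K u) (L'.comp L) 0 := hψ.differentiableAt.hasFDerivAt.comp 0 hd
  have hev : (gaugeFlowMap F K (invGauge F K u) ∘ gaugeFlowMap F K u) =ᶠ[𝓝 0] id := by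
    filter_upwards [eventually_actU_small F K u hu] with w hw
    exact gaugeFlowMap_invGauge_gaugeFlowMap F K u w (fun b => (hw b).1.le) fun b => (hw b).2
  have hid : HasFDerivAt (id : (Fin (recordChartDimJ F K) → ℂ) → (Fin (recordChartDimJ F K) → ℂ)) (L'.comp L) 0 :=
    hcomp.congr_of_eventuallyEq hev.symm
  have heq : L'.comp L = ContinuousLinearMap.id ℂ _ := hid.unique (hasFDerivAt_id 0)
  have hinj : Function.Injective L := fun x y hxy => by
    have := congrArg L' hxy
    rwa [← ContinuousLinearMap.comp_apply, ← ContinuousLinearMap.comp_apply, heq] at this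
  exact LinearMap.surjective_of_injective (f := (L : (Fin (recordChartDimJ F K) → ℂ) →ₗ[ℂ] (Fin (recordChartDimJ F K) → ℂ))) hinj

/-- ★★ CLAUSE 2 (eventual form of `ChartGaugeFlow`). [cite: Balaban1987RG1, (4.8) p.283] -/
theorem eventually_hasFDerivAt_gaugeFlowMap_surjective (K : ℕ) (lam : Site (F.P K) 0 → Fin 3 → ℂ) :
    ∀ᶠ t in 𝓝 (0 : ℝ), HasFDerivAt (gaugeFlowMap F K (expGauge F K lam t)) (fderiv ℂ (gaugeFlowMap F K (expGauge F K lam t)) 0) 0 ∧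
      Function.Surjective (fderiv ℂ (gaugeFlowMap F K (expGauge F K lam t)) 0) := by
  filter_upwards [eventually_actU_expGauge_zero F K lam] with t ht
  exact hasFDerivAt_gaugeFlowMap_surjective F K _ ht

/-! ## §8  ★★★ LEAF (B) OF NODE v8 AT THE RECORD: `ChartGaugeFlow recordAct recordCoords recordChartJ recordGradLeg` along any member sequence `K n` -/

/-- ★★★ **LEAF (B) — THE STRUCTURAL ROW OF NODE v8 IS INHABITED AT THE RECORD, HONESTLY**: for every member `n`, every catalogue letter `Mc`, level `k` and
EVERY site function `λ : sites → ℂ³`, the (4.8) flow `t ↦ exp(tΛ_λ)` in the record's NAMED gauge group, its flow map on the two-block chart inputs and that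
map's derivative at `0` witness `ChartGaugeFlow (recordAct) (recordCoords) (recordChartJ) (recordGradLeg)`: the NAMED chart intertwines the flow map with the
NAMED action on the NAMED coordinates of every domain (for `t`, then the chart input, near `0`), the flow map is differentiable at `0` with a surjective
derivative (for `t` near `0`), fixes the origin at `t = 0`, and the orbit of the origin has velocity the lattice gradient `recordGradLeg λ`.  With ◆ CRIT-1's
binding condition: `P n` = ALL site functions (no constrained sub-class).  HONEST: record-level calculus; nothing of Bałaban is discharged; K0ᴬ OPEN.
[cite: Balaban1987RG1, (4.7)–(4.8) pp.282–283, (1.7) p.261, (1.10) p.262, (4.15) p.284] -/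
theorem chartGaugeFlow_record (Mc k : ℕ) (K : ℕ → ℕ) :
    B12ChartGaugeFlow48.ChartGaugeFlow (S := fun n => recordDomSys F Mc k (K n)) (M := fun n => recordBondCount F (K n)) (m := fun n => recordChartDimJ F (K n))
      (Gg := fun n => recordGaugeGrp F (K n)) (P := fun n => Site (F.P (K n)) 0 → Fin 3 → ℂ)
      (fun n => recordAct F (K n)) (fun n => recordCoords F Mc k (K n)) (fun n => recordChartJ F Mc k (K n)) (fun n => recordGradLeg F (K n)) := by
  intro n lam
  exact ⟨expGauge F (K n) lam, fun t => gaugeFlowMap F (K n) (expGauge F (K n) lam t),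
    fun t => fderiv ℂ (gaugeFlowMap F (K n) (expGauge F (K n) lam t)) 0,
    eventually_recordChartJ_gaugeFlowMap F Mc k (K n) lam, eventually_hasFDerivAt_gaugeFlowMap_surjective F (K n) lam,
    gaugeFlowMap_expGauge_zero F (K n) lam, hasDerivAt_gaugeFlowMap_expGauge F (K n) lam⟩

end Summit.QuantumFields.YangMills.Theorems.K0AxGaugeFlowRec

end
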